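import Literature.NumberTheory.EllipticCurves.ModularCurve
import Summits.BirchSwinnertonDyer.BirchSwinnertonDyer.Theorems.SchneiderFreeAdditiveX3GordTwoBranchIMCDivOfKY
import Summits.BirchSwinnertonDyer.Rank1Residual.X11b.BDPFrameUniqueness
import Summits.BirchSwinnertonDyer.Rank1Residual.Partition.IrreducibleOverQuadraticField
import Literature.NumberTheory.EllipticCurves.BurungaleCastellaSkinner2025.BDPMainConjecture
import HarnessLib

/-!
# Route `UniversalToricDescent`, crux #3 `TwinSplitIMCAtThree` (item stmt-BirchSwinnertonDyer-20214):
# the `⊇`-half at `p = 3` for GOOD-ORDINARY twins, read from print (Burungale–Castella–Skinner 2025,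
# Thm. 4.2.1 (b) = Howard 2004 Thm. B + the Burungale–Castella–Kim 2021 transfer, stated at ODD `p`)

Seat `bsd-wall-utd-p2` (D-0131 (3) MIDDLE tier, strategy «twin-split IMC at 3, ⊇-half only: Howard
2004 / BCK21 transfer pushed to `p = 3` on the 2 023 twin classes»). Kernel-checked, sorry-free,
CONDITIONAL on ONE named published fact taken as a hypothesis (`h421` =
`BurungaleCastellaSkinner2025.thm421b_exists_isBDPLFunction_isTorsion_mem_charIdeal`, IMRN 2025
rnaf082 Thm. 4.2.1 (b) with its "Moreover" clause, printed for "`p` an odd prime of good ordinary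
reduction" — `[corpus: paper:arxiv-2405.00270 p0008 L75–L112]`, read first-hand — hence valid at
`p = 3`; its printed proof is "[How04, Thm. B]" + "[BCK21, Thm. 5.2]").

What is proved here, in the EXACT currency of the crux (`IsBDPLFunction ι′ 𝔭 κ γ Dt′.f Ω_K Ω_p L′`,
`X11b.AcSelmer.XAc.charIdeal (W′.baseChange K) 3 κ 𝔭′ ∅ γ` extended along `Halves.toUnr 3`):

* `exists_frame_isTorsion_mem_charIdeal_of_goodOrd` — for a twin `W′` GOOD ORDINARY at `3` with
  `ρ̄_{W′,3}` onto, `K` imaginary quadratic with the (classical) Heegner hypothesis for `N′` and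
  (disc) `D_K` odd, `D_K ≠ −3`, `κ` anticyclotomic, `3 = 𝔭𝔭′` (`𝔭′ ≠ 𝔭`), `ι′` inducing `𝔭`: there is
  a BDP frame `(Ω_K ≠ 0, Ω_p ∈ R₀ˣ, L′)` of `f_{W′}` at `(ι′, 𝔭)` such that `X_ac(W′/K_∞)` strict at
  `𝔭′` is `Λ`-torsion and `L′ ∈ Ch_Λ(X_ac)·R₀⟦T⟧` — i.e. conjunct (i) of the crux AND the `⊇`-half of
  conjunct (ii) AT THAT FRAME. Bookkeeping supplied by the tree: `3` splits in `K`
  (`SchneiderFree.ncard_primesOver_eq_two_of_degreeOne`), (irr_K) from (sur) over `ℚ`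
  (`Rank1Residual.irrK_of_surj`), the structure map `toUnr 3` satisfies BCS's `hj` (`Halves.coe_toUnr`),
  and the Literature-side `X_ac` of the fact IS the Summits-side `X_ac` of the crux (`rfl`).
* `crux_conjunct_one_and_supset_at_frame_of_goodOrd` — the same, printed in the crux's literal
  shape: `(∃ Ω_K Ω_p L′, Ω_K ≠ 0 ∧ Ω_p ≠ 0 ∧ IsBDPLFunction … L′ ∧ Ideal.span {L′} ≤ Ch·R₀⟦T⟧)`.
* `forall_frame_mem_charIdeal_of_goodOrd_of_supply` — AT THE PERIODS OF THAT FRAME, every `L″`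
  with the same interpolation data lies in `Ch·R₀⟦T⟧` (frame rigidity at fixed periods,
  `X11b.isBDPLFunction_forall_of_exists_of_tendsto`, under the tree's SUPPLY hypothesis of
  interpolation characters accumulating at `𝟙`).

What this does NOT do (numbers, not adjectives): (a) the `⊆`-half of (ii) (BCS 2025 p. 5: "the only
missing ingredient is the divisibility of [Wan15], which assumes `p > 3`") — not touched; (b) the
crux's clause (ii) quantifies over ALL `(Ω_K ≠ 0, Ω_p ≠ 0)` in `ℂ × ℂ_3`, whereas print pins the CM
periods: frames with different period ratios are not compared by any tree theorem
(`BDPFrameUniqueness.lean`, "WHAT THIS DOES NOT DO"), so the `⊇`-half is landed at the printed frame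
(and at its periods), not for every frame; (c) the crux quantifies over all semistable twins and all
Heegner `K`: the two EXTRA hypotheses here are `GoodOrd W′ 3` (census TWIN-PRINT-AT3-v1 bucket A:
745 of the 2 023 twin classes have such a twin; buckets B = 675 (only `3 ∥ N′` twins) and C = 603
(only supersingular twins) are not touched) and (disc). Beyond-print theorem: NO — this is print
(BCS25 Thm. 4.2.1 (b)) wired to the crux's currency. `--supports stmt-BirchSwinnertonDyer-20214`.

References: [BurungaleCastellaSkinner2025] Thm. 4.2.1 (b) (arXiv:2405.00270v2 p. 8);
[Howard2004HeegnerKolyvagin] Thm. B; [BurungaleCastellaKim2021] Thm. 5.2 (A&NT 15; standing `p > 3`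
there, restated at odd `p` by BCS); [CastellaHsieh2018] Prop. 3.8; [Castella2018] Thm. 3.1.
-/

noncomputable section

open scoped Classical

set_option linter.dupNamespace false
set_option autoImplicit false

namespace Summit.BirchSwinnertonDyer.BirchSwinnertonDyer.Theorems.UniversalToricDescentTwinSplit

open Filter Topology WeierstrassCurve NumberField IsDedekindDomain Field PowerSeries
  Literature.NumberTheory.EllipticCurves
  Literature.NumberTheory.EllipticCurves.ModularForms
  Literature.NumberTheory.EllipticCurves.Rank1Residual
  Literature.NumberTheory.GaloisRepresentations
  Summit.BirchSwinnertonDyer.Rank1Residual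
  Summit.BirchSwinnertonDyer.Rank1Residual.X11b
  Summit.BirchSwinnertonDyer.Rank1Residual.X11b.Halves
  Summit.BirchSwinnertonDyer.BirchSwinnertonDyer.Theorems.SchneiderFree

/-- **The `⊇`-half of crux #3 at a good-ordinary twin, at the printed frame (BCS 2025 Thm. 4.2.1 (b)
at `p = 3`).** Data: `W′/ℚ` globally minimal, good ORDINARY at `3` (`GoodOrd W′ 3`), `ρ̄_{W′,3}` onto;
`Dt′` a modular parametrisation datum of level `N′` (`Dt′.isNewformOf`); `K` imaginary quadratic with
the Heegner hypothesis for `N′` and (disc) `D_K` odd, `D_K ≠ −3`; `κ` anticyclotomic with topological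
generator `γ`; `𝔭 ∋ 3` of degree one (so `3` splits), `𝔭′ ∋ 3`, `𝔭′ ≠ 𝔭`; `ι′` inducing `𝔭`.
Conclusion: a frame `(Ω_K ≠ 0, Ω_p ∈ R₀ˣ, L′)` with `IsBDPLFunction ι′ 𝔭 κ γ Dt′.f Ω_K Ω_p L′`,
`X_ac(W′_K)` strict at `𝔭′` `Λ`-torsion, and `L′ ∈ Ch_Λ(X_ac)·R₀⟦T⟧` along `toUnr 3`. CONDITIONAL on
the named fact `h421`. [cite: BurungaleCastellaSkinner2025, Thm. 4.2.1 (b) and "Moreover" (§4.2, p. 8 of arXiv:2405.00270v2)] -/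
theorem exists_frame_isTorsion_mem_charIdeal_of_goodOrd
    (h421 : BurungaleCastellaSkinner2025.thm421b_exists_isBDPLFunction_isTorsion_mem_charIdeal)
    (W' : WeierstrassCurve ℚ) [W'.IsElliptic] [W'.IsGloballyMinimal] (N' : ℕ) [NeZero N']
    (K : Type) [Field K] [NumberField K] (Dt' : ModularParametrizationData W' N')
    (hord : GoodOrd W' 3) (hsurj : W'.HasSurjectiveModNGaloisRep 3)
    (hK : IsImaginaryQuadratic K) (hH : SatisfiesHeegnerHypothesis N' K)
    (hodd : Odd (NumberField.discr K)) (hd3 : NumberField.discr K ≠ -3)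
    (κ : ZpExtension K 3) (hκ : κ.IsAnticyclotomic) (γ : absoluteGaloisGroup K)
    [Fact (κ.IsTopGenerator γ)]
    (𝔭 : HeightOneSpectrum (𝓞 K)) (h𝔭 : ((3 : ℕ) : 𝓞 K) ∈ 𝔭.asIdeal)
    (he : 𝔭.asIdeal.ramificationIdx (𝓞 ℚ) = 1) (hf : 𝔭.asIdeal.inertiaDeg (𝓞 ℚ) = 1)
    (𝔭' : HeightOneSpectrum (𝓞 K)) (h𝔭' : ((3 : ℕ) : 𝓞 K) ∈ 𝔭'.asIdeal) (hne : 𝔭' ≠ 𝔭)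
    (ι' : PadicAlgCl 3 ≃+* ℂ) (hι' : BranchInducesPrime 3 ι' 𝔭) :
    ∃ (ΩK : ℂ) (Ωp : (unrIntegers 3)ˣ) (L' : UnrSeries 3),
      ΩK ≠ 0 ∧ IsBDPLFunction ι' 𝔭 κ γ Dt'.f ΩK ((Ωp : unrIntegers 3) : ℂ_[3]) L' ∧
      Module.IsTorsion (IwasawaAlgebra 3) (AcSelmer.XAc (W'.baseChange K) 3 κ 𝔭' ∅ γ) ∧
      L' ∈ (AcSelmer.XAc.charIdeal (W'.baseChange K) 3 κ 𝔭' ∅ γ).map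
        (PowerSeries.map (toUnr 3)) := by
  have h2 : Module.finrank ℚ K = 2 := hK.1
  have hspl : ((Ideal.span {((3 : ℕ) : ℤ)}).primesOver (𝓞 K)).ncard = 2 :=
    ncard_primesOver_eq_two_of_degreeOne h2 h𝔭 he hf
  have hirrK : (W'.baseChange K).HasIrreducibleModPGaloisRep 3 := irrK_of_surj W' 3 hsurj K h2
  obtain ⟨ΩK, Ωp, L, hΩK, hL, htors, hdiv⟩ :=
    h421 ι' W' K 𝔭 𝔭' κ γ Dt'.isNewformOf (by decide) hord hK hH hspl hodd hd3 hirrK hι' h𝔭' hne hκ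
  refine ⟨ΩK, Ωp, L, hΩK, hL, ?_, ?_⟩
  · exact htors
  · have hmem := (hdiv (toUnr 3) (coe_toUnr 3)).2 hsurj
    have hbr : AcSelmer.XAc.charIdeal (W'.baseChange K) 3 κ 𝔭' ∅ γ =
        Literature.NumberTheory.EllipticCurves.Castella2018.AcSelmer.XAc.charIdeal
          (W'.baseChange K) 3 κ 𝔭' ∅ γ :=
      xac_charIdeal_eq_literature (W'.baseChange K) 3 κ 𝔭' ∅ γ
    rw [hbr]
    exact hmem

/-- **Crux #3's conjunct (i) verbatim, and the `⊇`-half of (ii) at that frame, for a good-ordinary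
twin** — the previous theorem printed in the literal shape of
`Theses.UniversalToricDescent.TwinSplitIMCAtThree`: `(∃ Ω_K Ω_p L′, Ω_K ≠ 0 ∧ Ω_p ≠ 0 ∧
IsBDPLFunction ι′ 𝔭 κ γ Dt′.f Ω_K Ω_p L′ ∧ (L′) ⊆ Ch_Λ(X_ac(W′_K) strict at 𝔭′)·R₀⟦T⟧)` (`Ω_p ∈ R₀ˣ`
has norm `1`, so `Ω_p ≠ 0` in `ℂ_3`). CONDITIONAL on `h421`.
[cite: BurungaleCastellaSkinner2025, Thm. 4.2.1 (b) (§4.2, p. 8 of arXiv:2405.00270v2)] -/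
theorem crux_conjunct_one_and_supset_at_frame_of_goodOrd
    (h421 : BurungaleCastellaSkinner2025.thm421b_exists_isBDPLFunction_isTorsion_mem_charIdeal)
    (W' : WeierstrassCurve ℚ) [W'.IsElliptic] [W'.IsGloballyMinimal] (N' : ℕ) [NeZero N']
    (K : Type) [Field K] [NumberField K] (Dt' : ModularParametrizationData W' N')
    (hord : GoodOrd W' 3) (hsurj : W'.HasSurjectiveModNGaloisRep 3)
    (hK : IsImaginaryQuadratic K) (hH : SatisfiesHeegnerHypothesis N' K)
    (hodd : Odd (NumberField.discr K)) (hd3 : NumberField.discr K ≠ -3)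
    (κ : ZpExtension K 3) (hκ : κ.IsAnticyclotomic) (γ : absoluteGaloisGroup K)
    [Fact (κ.IsTopGenerator γ)]
    (𝔭 : HeightOneSpectrum (𝓞 K)) (h𝔭 : ((3 : ℕ) : 𝓞 K) ∈ 𝔭.asIdeal)
    (he : 𝔭.asIdeal.ramificationIdx (𝓞 ℚ) = 1) (hf : 𝔭.asIdeal.inertiaDeg (𝓞 ℚ) = 1)
    (𝔭' : HeightOneSpectrum (𝓞 K)) (h𝔭' : ((3 : ℕ) : 𝓞 K) ∈ 𝔭'.asIdeal) (hne : 𝔭' ≠ 𝔭)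
    (ι' : PadicAlgCl 3 ≃+* ℂ) (hι' : BranchInducesPrime 3 ι' 𝔭) :
    ∃ (ΩK : ℂ) (Ωp : ℂ_[3]) (L' : UnrSeries 3), ΩK ≠ 0 ∧ Ωp ≠ 0 ∧
      IsBDPLFunction ι' 𝔭 κ γ Dt'.f ΩK Ωp L' ∧
      Ideal.span {L'} ≤ (AcSelmer.XAc.charIdeal (W'.baseChange K) 3 κ 𝔭' ∅ γ).map
        (PowerSeries.map (toUnr 3)) := by
  obtain ⟨ΩK, Ωp, L, hΩK, hL, -, hmem⟩ := exists_frame_isTorsion_mem_charIdeal_of_goodOrd h421 W'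
    N' K Dt' hord hsurj hK hH hodd hd3 κ hκ γ 𝔭 h𝔭 he hf 𝔭' h𝔭' hne ι' hι'
  refine ⟨ΩK, ((Ωp : unrIntegers 3) : ℂ_[3]), L, hΩK, ?_, hL, ?_⟩
  · intro h0
    have h1 := norm_coe_units_unrIntegers 3 Ωp
    rw [h0, norm_zero] at h1
    exact zero_ne_one h1
  · rw [Ideal.span_singleton_le_iff_mem]
    exact hmem

/-- **At the periods of the printed frame, EVERY series with the same interpolation data lies in
`Ch_Λ(X_ac)·R₀⟦T⟧`** (frame rigidity at fixed periods, `X11b.isBDPLFunction_forall_of_exists_of_tendsto`),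
granted the tree's SUPPLY hypothesis: interpolation data `(φ_k, n_k, r_k)` (`φ_k` unramified of
infinity type `(n_k, −n_k)`, `n_k > 0`, avatar `r_k` through `κ`) with `φ̂_k(γ) → 1`, `φ̂_k(γ) ≠ 1`
infinitely often. This is the `⊇`-half of the crux's clause (ii) restricted to frames with the
printed periods; frames with other period ratios are not compared by any tree theorem. CONDITIONAL
on `h421`. [cite: BurungaleCastellaSkinner2025, Thm. 4.2.1 (b) (§4.2, p. 8 of arXiv:2405.00270v2)]
[cite: Castella2018, Thm. 3.1 (arXiv:1704.06608 p. 9) (the interpolation property pinning `L`)] -/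
theorem forall_frame_mem_charIdeal_of_goodOrd_of_supply
    (h421 : BurungaleCastellaSkinner2025.thm421b_exists_isBDPLFunction_isTorsion_mem_charIdeal)
    (W' : WeierstrassCurve ℚ) [W'.IsElliptic] [W'.IsGloballyMinimal] (N' : ℕ) [NeZero N']
    (K : Type) [Field K] [NumberField K] (Dt' : ModularParametrizationData W' N')
    (hord : GoodOrd W' 3) (hsurj : W'.HasSurjectiveModNGaloisRep 3)
    (hK : IsImaginaryQuadratic K) (hH : SatisfiesHeegnerHypothesis N' K)
    (hodd : Odd (NumberField.discr K)) (hd3 : NumberField.discr K ≠ -3)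
    (κ : ZpExtension K 3) (hκ : κ.IsAnticyclotomic) (γ : absoluteGaloisGroup K)
    [Fact (κ.IsTopGenerator γ)]
    (𝔭 : HeightOneSpectrum (𝓞 K)) (h𝔭 : ((3 : ℕ) : 𝓞 K) ∈ 𝔭.asIdeal)
    (he : 𝔭.asIdeal.ramificationIdx (𝓞 ℚ) = 1) (hf : 𝔭.asIdeal.inertiaDeg (𝓞 ℚ) = 1)
    (𝔭' : HeightOneSpectrum (𝓞 K)) (h𝔭' : ((3 : ℕ) : 𝓞 K) ∈ 𝔭'.asIdeal) (hne : 𝔭' ≠ 𝔭)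
    (ι' : PadicAlgCl 3 ≃+* ℂ) (hι' : BranchInducesPrime 3 ι' 𝔭)
    {φ : ℕ → HeckeCharacter K} {n : ℕ → ℕ} {r : ℕ → FramedGaloisRep K (PadicAlgCl 3) 1}
    (hn : ∀ k, 0 < n k) (hunr : ∀ k (v : HeightOneSpectrum (𝓞 K)), (φ k).IsUnramifiedAt v)
    (hinf : ∀ k, (φ k).HasInfinityType (fun _ ↦ (n k : ℤ)) (fun _ ↦ -(n k : ℤ)))
    (hr : ∀ k, IsPAdicAvatarOf ι' (φ k) (r k)) (hκr : ∀ k, FactorsThroughZp κ (r k))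
    (hlim : Tendsto (fun k ↦ avatarValueAt (r k) γ) atTop (𝓝 1))
    (hne1 : ∃ᶠ k in atTop, avatarValueAt (r k) γ ≠ 1) :
    ∃ (ΩK : ℂ) (Ωp : (unrIntegers 3)ˣ), ΩK ≠ 0 ∧
      (∃ L', IsBDPLFunction ι' 𝔭 κ γ Dt'.f ΩK ((Ωp : unrIntegers 3) : ℂ_[3]) L') ∧
      ∀ L'' : UnrSeries 3, IsBDPLFunction ι' 𝔭 κ γ Dt'.f ΩK ((Ωp : unrIntegers 3) : ℂ_[3]) L'' →
        L'' ∈ (AcSelmer.XAc.charIdeal (W'.baseChange K) 3 κ 𝔭' ∅ γ).map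
          (PowerSeries.map (toUnr 3)) := by
  obtain ⟨ΩK, Ωp, L, hΩK, hL, -, hmem⟩ := exists_frame_isTorsion_mem_charIdeal_of_goodOrd h421 W'
    N' K Dt' hord hsurj hK hH hodd hd3 κ hκ γ 𝔭 h𝔭 he hf 𝔭' h𝔭' hne ι' hι'
  refine ⟨ΩK, Ωp, hΩK, ⟨L, hL⟩, fun L'' hL'' ↦ ?_⟩
  exact isBDPLFunction_forall_of_exists_of_tendsto
    (P := fun M ↦ M ∈ (AcSelmer.XAc.charIdeal (W'.baseChange K) 3 κ 𝔭' ∅ γ).map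
      (PowerSeries.map (toUnr 3)))
    hn hunr hinf hr hκr hlim hne1 ⟨L, hL, hmem⟩ hL''

end Summit.BirchSwinnertonDyer.BirchSwinnertonDyer.Theorems.UniversalToricDescentTwinSplit

end
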